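import Literature.NumberTheory.EllipticCurves.RealLatticeCovolumeProofs
import Literature.NumberTheory.EllipticCurves.ModularCurveRealPeriodProofs
import Literature.NumberTheory.EllipticCurves.WeierstrassAdditionProofs
import HarnessLib

/-!
# Rectangular real lattices: bookkeeping for the quarter-period rectangle

Helper file for the support item `EllipticAreaIdentity` of route `MultivaluedCoV`
(`Summits/KontsevichZagierPeriods/KontsevichZagierPeriods/Theses/MultivaluedCoV.lean`).

For a **real** lattice `Λ` (Mathlib `PeriodPair` `L` with `L.IsReal`) which is **rectangular**
(`(Ω₀ + iΩ₀')/2 ∉ Λ`, where `Ω₀ = L.minRealPeriod` and `Ω₀'` is the least positive real period of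
the rotated lattice `iΛ`; this is the case `g₂³ − 27g₃² > 0`,
`PeriodPair.IsReal.half_sum_notMem_of_discr_pos`) we record:

* `Λ = ℤΩ₀ ⊕ ℤ iΩ₀'` read coordinatewise (`mem_lattice_iff_of_rect`, `re_im_of_mem_lattice`),
  so a lattice point with `|re| < Ω₀` has `re = 0`, etc.;
* reduction of any point modulo `Λ` into the closed period rectangle
  `|re| ≤ Ω₀/2, |im| ≤ Ω₀'/2` (`exists_sub_mem_lattice_abs_le`);
* `℘` is real at every `z` with `z + z̄ ∈ Λ` or `z − z̄ ∈ Λ` (the grid lines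
  `re z ∈ ½ℤΩ₀`, `im z ∈ ½ℤΩ₀'`; Lawden, *Elliptic Functions and Applications*, §6.11);
* `℘` is injective on the open quarter rectangle `(0, Ω₀/2) × (−Ω₀'/2, 0)` (it takes each value
  twice modulo `Λ`, at `±z`: tree `PeriodPair.weierstrassP_eq_weierstrassP_iff`).

These are the lattice-side inputs for "`℘` maps the open quarter rectangle bijectively onto an
open half-plane" (Lawden §6.11–6.12; Whittaker–Watson ch. 20), used to present the addition law
of `y² = 4x³ − g₂x − g₃` as a change of variables of the Kontsevich–Zagier calculus.

## References
* D. F. Lawden, *Elliptic Functions and Applications*, Springer 1989, §§6.11–6.12, 6.15.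
* E. T. Whittaker, G. N. Watson, *A Course of Modern Analysis*, ch. 20.
-/

noncomputable section

open scoped ComplexConjugate Topology PeriodPair
open Complex Set Filter

namespace Summit.KontsevichZagierPeriods.MultivaluedCoV.EllipticArea

variable {L : PeriodPair}

/-! ### The rectangular lattice coordinatewise -/

/-- A rectangular real lattice is `ℤΩ₀ ⊕ ℤ iΩ₀'`
(`PeriodPair.IsReal.exists_eq_lattice`, rectangular case). -/
theorem mem_lattice_iff_of_rect (h : L.IsReal)
    (hrect : ((L.minRealPeriod : ℂ) + I * (L.mulLeft I I_ne_zero).minRealPeriod) / 2 ∉ L.lattice)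
    {z : ℂ} :
    z ∈ L.lattice ↔ ∃ m n : ℤ, (m : ℂ) * L.minRealPeriod +
      n * (I * (L.mulLeft I I_ne_zero).minRealPeriod) = z := by
  obtain ⟨L₀, hL₀, hω₁, hω₂⟩ := h.exists_eq_lattice
  rw [if_neg hrect] at hω₂
  rw [← hL₀, PeriodPair.mem_lattice, hω₁, hω₂]

/-- Coordinates of a point of a rectangular real lattice: `re z ∈ ℤΩ₀`, `im z ∈ ℤΩ₀'`. -/
theorem re_im_of_mem_lattice (h : L.IsReal)
    (hrect : ((L.minRealPeriod : ℂ) + I * (L.mulLeft I I_ne_zero).minRealPeriod) / 2 ∉ L.lattice)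
    {z : ℂ} (hz : z ∈ L.lattice) :
    ∃ m n : ℤ, z.re = m * L.minRealPeriod ∧
      z.im = n * (L.mulLeft I I_ne_zero).minRealPeriod := by
  obtain ⟨m, n, rfl⟩ := (mem_lattice_iff_of_rect h hrect).1 hz
  exact ⟨m, n, by simp, by simp⟩

/-- A real number `m Ω` with `m ∈ ℤ` and `|m Ω| < Ω` (`Ω > 0`) vanishes. -/
theorem int_mul_eq_zero_of_abs_lt {m : ℤ} {Ω : ℝ} (hΩ : 0 < Ω) (h : |(m : ℝ) * Ω| < Ω) :
    (m : ℝ) * Ω = 0 := by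
  rw [abs_mul, abs_of_pos hΩ] at h
  have h1 : |(m : ℝ)| < 1 := (mul_lt_iff_lt_one_left hΩ).mp h
  have h2 : |m| < 1 := by exact_mod_cast h1
  rw [Int.abs_lt_one_iff] at h2
  simp [h2]

/-- In a rectangular real lattice, a lattice point with `|re z| < Ω₀` has `re z = 0`. -/
theorem re_eq_zero_of_mem_lattice (h : L.IsReal)
    (hrect : ((L.minRealPeriod : ℂ) + I * (L.mulLeft I I_ne_zero).minRealPeriod) / 2 ∉ L.lattice)
    {z : ℂ} (hz : z ∈ L.lattice) (hre : |z.re| < L.minRealPeriod) : z.re = 0 := by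
  obtain ⟨m, n, hm, -⟩ := re_im_of_mem_lattice h hrect hz
  rw [hm] at hre ⊢
  exact int_mul_eq_zero_of_abs_lt h.minRealPeriod_pos hre

/-- In a rectangular real lattice, a lattice point with `|im z| < Ω₀'` has `im z = 0`. -/
theorem im_eq_zero_of_mem_lattice (h : L.IsReal)
    (hrect : ((L.minRealPeriod : ℂ) + I * (L.mulLeft I I_ne_zero).minRealPeriod) / 2 ∉ L.lattice)
    {z : ℂ} (hz : z ∈ L.lattice) (him : |z.im| < (L.mulLeft I I_ne_zero).minRealPeriod) :
    z.im = 0 := by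
  obtain ⟨m, n, -, hn⟩ := re_im_of_mem_lattice h hrect hz
  rw [hn] at him ⊢
  exact int_mul_eq_zero_of_abs_lt h.mulLeft_I.minRealPeriod_pos him

/-- A point with `re z ≠ 0`, `|re z| < Ω₀` is not in the (rectangular real) lattice. -/
theorem notMem_lattice_of_re (h : L.IsReal)
    (hrect : ((L.minRealPeriod : ℂ) + I * (L.mulLeft I I_ne_zero).minRealPeriod) / 2 ∉ L.lattice)
    {z : ℂ} (h0 : z.re ≠ 0) (h1 : |z.re| < L.minRealPeriod) : z ∉ L.lattice :=
  fun hz => h0 (re_eq_zero_of_mem_lattice h hrect hz h1)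

/-- A point with `im z ≠ 0`, `|im z| < Ω₀'` is not in the (rectangular real) lattice. -/
theorem notMem_lattice_of_im (h : L.IsReal)
    (hrect : ((L.minRealPeriod : ℂ) + I * (L.mulLeft I I_ne_zero).minRealPeriod) / 2 ∉ L.lattice)
    {z : ℂ} (h0 : z.im ≠ 0) (h1 : |z.im| < (L.mulLeft I I_ne_zero).minRealPeriod) :
    z ∉ L.lattice :=
  fun hz => h0 (im_eq_zero_of_mem_lattice h hrect hz h1)

/-- Reduction modulo a rectangular real lattice into the closed period rectangle
`|re| ≤ Ω₀/2`, `|im| ≤ Ω₀'/2`. -/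
theorem exists_sub_mem_lattice_abs_le (h : L.IsReal)
    (hrect : ((L.minRealPeriod : ℂ) + I * (L.mulLeft I I_ne_zero).minRealPeriod) / 2 ∉ L.lattice)
    (z : ℂ) :
    ∃ w : ℂ, w - z ∈ L.lattice ∧ |w.re| ≤ L.minRealPeriod / 2 ∧
      |w.im| ≤ (L.mulLeft I I_ne_zero).minRealPeriod / 2 := by
  set Ω := L.minRealPeriod with hΩ
  set Ω' := (L.mulLeft I I_ne_zero).minRealPeriod with hΩ'
  have hΩ0 : 0 < Ω := h.minRealPeriod_pos
  have hΩ'0 : 0 < Ω' := h.mulLeft_I.minRealPeriod_pos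
  set m : ℤ := round (z.re / Ω) with hm
  set n : ℤ := round (z.im / Ω') with hn
  refine ⟨z - ((m : ℂ) * Ω + n * (I * Ω')), ?_, ?_, ?_⟩
  · rw [show z - ((m : ℂ) * Ω + n * (I * Ω')) - z = ((-m : ℤ) : ℂ) * Ω + ((-n : ℤ) : ℂ) * (I * Ω')
      by push_cast; ring]
    exact (mem_lattice_iff_of_rect h hrect).2 ⟨-m, -n, rfl⟩
  · have hre : (z - ((m : ℂ) * Ω + n * (I * Ω'))).re = (z.re / Ω - m) * Ω := by
      simp only [sub_re, add_re, mul_re, intCast_re, ofReal_re, intCast_im, ofReal_im, mul_zero,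
        sub_zero, I_re, zero_mul, I_im, one_mul, mul_im, add_zero]
      field_simp
    rw [hre, abs_mul, abs_of_pos hΩ0]
    have := abs_sub_round (z.re / Ω)
    nlinarith
  · have him : (z - ((m : ℂ) * Ω + n * (I * Ω'))).im = (z.im / Ω' - n) * Ω' := by
      simp only [sub_im, add_im, mul_im, intCast_re, ofReal_im, intCast_im, ofReal_re, mul_zero,
        add_zero, I_re, I_im, zero_mul, one_mul, zero_add, mul_re, sub_zero]
      field_simp
    rw [him, abs_mul, abs_of_pos hΩ'0]
    have := abs_sub_round (z.im / Ω')
    nlinarith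

/-! ### `℘` is real on the grid lines -/

/-- For a real lattice, `℘(z)` is real whenever `z + z̄ ∈ Λ` (then `z̄ ≡ −z`, and `℘` is even and
`Λ`-periodic, so `℘(z̄) = ℘(z)`, while `℘(z̄) = conj ℘(z)`). -/
theorem weierstrassP_im_eq_zero_of_add_conj_mem (h : L.IsReal) {z : ℂ}
    (hz : z + conj z ∈ L.lattice) : (℘[L] z).im = 0 := by
  rw [← Complex.conj_eq_iff_im, ← h.weierstrassP_conj]
  have := L.weierstrassP_add_coe (-z) ⟨_, hz⟩
  rw [show -z + (z + conj z) = conj z by ring, L.weierstrassP_neg] at this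
  exact this

/-- For a real lattice, `℘(z)` is real whenever `z − z̄ ∈ Λ`. -/
theorem weierstrassP_im_eq_zero_of_sub_conj_mem (h : L.IsReal) {z : ℂ}
    (hz : z - conj z ∈ L.lattice) : (℘[L] z).im = 0 := by
  rw [← Complex.conj_eq_iff_im, ← h.weierstrassP_conj]
  have := L.weierstrassP_sub_coe z ⟨_, hz⟩
  rw [show z - (z - conj z) = conj z by ring] at this
  exact this

/-- `℘` is real on the vertical lines `2 re z ∈ ℤΩ₀` of a real lattice. -/
theorem weierstrassP_im_eq_zero_of_two_mul_re (h : L.IsReal) {z : ℂ} {k : ℤ}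
    (hk : 2 * z.re = k * L.minRealPeriod) : (℘[L] z).im = 0 := by
  refine weierstrassP_im_eq_zero_of_add_conj_mem h ?_
  rw [Complex.add_conj, show ((2 * z.re : ℝ) : ℂ) = (k : ℂ) * (L.minRealPeriod : ℂ) by
    rw [hk]; push_cast; ring]
  exact PeriodPair.intCast_mul_mem h.minRealPeriod_mem_lattice k

/-- `℘` is real on the horizontal lines `2 im z ∈ ℤΩ₀'` of a real lattice. -/
theorem weierstrassP_im_eq_zero_of_two_mul_im (h : L.IsReal) {z : ℂ} {k : ℤ}
    (hk : 2 * z.im = k * (L.mulLeft I I_ne_zero).minRealPeriod) : (℘[L] z).im = 0 := by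
  refine weierstrassP_im_eq_zero_of_sub_conj_mem h ?_
  rw [Complex.sub_conj, show ((2 * z.im : ℝ) : ℂ) * I =
      (k : ℂ) * (I * ((L.mulLeft I I_ne_zero).minRealPeriod : ℂ)) by rw [hk]; push_cast; ring]
  exact PeriodPair.intCast_mul_mem h.I_mul_minRealPeriod_mem k

/-- If `℘(z)` is not real and `|re z| ≤ Ω₀/2`, then `0 < |re z| < Ω₀/2`. -/
theorem abs_re_pos_lt_of_im_ne_zero (h : L.IsReal) {z : ℂ} (hz : (℘[L] z).im ≠ 0)
    (hre : |z.re| ≤ L.minRealPeriod / 2) : 0 < |z.re| ∧ |z.re| < L.minRealPeriod / 2 := by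
  constructor
  · rw [abs_pos]
    intro h0
    exact hz (weierstrassP_im_eq_zero_of_two_mul_re h (k := 0) (by rw [h0]; simp))
  · rcases hre.lt_or_eq with hlt | heq
    · exact hlt
    · exfalso
      rcases abs_eq (by linarith [h.minRealPeriod_pos] : (0 : ℝ) ≤ L.minRealPeriod / 2) |>.mp heq
        with h1 | h1
      · exact hz (weierstrassP_im_eq_zero_of_two_mul_re h (k := 1) (by rw [h1]; push_cast; ring))
      · exact hz (weierstrassP_im_eq_zero_of_two_mul_re h (k := -1) (by rw [h1]; push_cast; ring))

/-- If `℘(z)` is not real and `|im z| ≤ Ω₀'/2`, then `0 < |im z| < Ω₀'/2`. -/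
theorem abs_im_pos_lt_of_im_ne_zero (h : L.IsReal) {z : ℂ} (hz : (℘[L] z).im ≠ 0)
    (him : |z.im| ≤ (L.mulLeft I I_ne_zero).minRealPeriod / 2) :
    0 < |z.im| ∧ |z.im| < (L.mulLeft I I_ne_zero).minRealPeriod / 2 := by
  constructor
  · rw [abs_pos]
    intro h0
    exact hz (weierstrassP_im_eq_zero_of_two_mul_im h (k := 0) (by rw [h0]; simp))
  · rcases him.lt_or_eq with hlt | heq
    · exact hlt
    · exfalso
      rcases abs_eq (by linarith [h.mulLeft_I.minRealPeriod_pos] :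
        (0 : ℝ) ≤ (L.mulLeft I I_ne_zero).minRealPeriod / 2) |>.mp heq with h1 | h1
      · exact hz (weierstrassP_im_eq_zero_of_two_mul_im h (k := 1) (by rw [h1]; push_cast; ring))
      · exact hz (weierstrassP_im_eq_zero_of_two_mul_im h (k := -1) (by rw [h1]; push_cast; ring))

/-! ### The open quarter rectangle `(0, Ω₀/2) × (−Ω₀'/2, 0)` -/

/-- A point of the open quarter rectangle is not a lattice point. -/
theorem notMem_lattice_of_mem_quarter (h : L.IsReal)
    (hrect : ((L.minRealPeriod : ℂ) + I * (L.mulLeft I I_ne_zero).minRealPeriod) / 2 ∉ L.lattice)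
    {z : ℂ} (h0 : 0 < z.re) (h1 : z.re < L.minRealPeriod / 2) : z ∉ L.lattice :=
  notMem_lattice_of_re h hrect h0.ne' (by rw [abs_of_pos h0]; linarith [h.minRealPeriod_pos])

/-- For a point of the open quarter rectangle, `2z ∉ Λ`, hence `℘'(z) ≠ 0`. -/
theorem derivWeierstrassP_ne_zero_of_mem_quarter (h : L.IsReal)
    (hrect : ((L.minRealPeriod : ℂ) + I * (L.mulLeft I I_ne_zero).minRealPeriod) / 2 ∉ L.lattice)
    {z : ℂ} (h0 : 0 < z.re) (h1 : z.re < L.minRealPeriod / 2) : ℘'[L] z ≠ 0 := by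
  intro hd
  have h2 := L.two_mul_mem_lattice_of_derivWeierstrassP_eq_zero
    (notMem_lattice_of_mem_quarter h hrect h0 h1) hd
  refine notMem_lattice_of_re h hrect (z := 2 * z) ?_ ?_ h2
  · simp; exact h0.ne'
  · have : (2 * z).re = 2 * z.re := by simp
    rw [this, abs_of_pos (by linarith)]
    linarith

/-- **`℘` is injective on the open quarter rectangle** `(0, Ω₀/2) × (−Ω₀'/2, 0)` of a rectangular
real lattice: `℘(z) = ℘(z')` forces `z ± z' ∈ Λ` (`PeriodPair.weierstrassP_eq_weierstrassP_iff`),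
and `0 < re (z + z') < Ω₀`, `|re (z − z')| , |im (z − z')|` small. (Lawden §6.11.) -/
theorem injOn_weierstrassP_quarter (h : L.IsReal)
    (hrect : ((L.minRealPeriod : ℂ) + I * (L.mulLeft I I_ne_zero).minRealPeriod) / 2 ∉ L.lattice) :
    InjOn ℘[L] {z : ℂ | 0 < z.re ∧ z.re < L.minRealPeriod / 2 ∧
      -((L.mulLeft I I_ne_zero).minRealPeriod / 2) < z.im ∧ z.im < 0} := by
  intro z hz z' hz' heq
  have hΩ := h.minRealPeriod_pos
  have hΩ' := h.mulLeft_I.minRealPeriod_pos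
  have hzΛ := notMem_lattice_of_mem_quarter h hrect hz.1 hz.2.1
  have hz'Λ := notMem_lattice_of_mem_quarter h hrect hz'.1 hz'.2.1
  rcases (L.weierstrassP_eq_weierstrassP_iff hzΛ hz'Λ).1 heq with hadd | hsub
  · exfalso
    have := re_eq_zero_of_mem_lattice h hrect hadd (by
      rw [add_re, abs_of_pos (by linarith [hz.1, hz'.1])]; linarith [hz.2.1, hz'.2.1])
    rw [add_re] at this
    linarith [hz.1, hz'.1]
  · have hre := re_eq_zero_of_mem_lattice h hrect hsub (by
      rw [sub_re, abs_lt]; constructor <;> linarith [hz.1, hz'.1, hz.2.1, hz'.2.1])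
    have him := im_eq_zero_of_mem_lattice h hrect hsub (by
      rw [sub_im, abs_lt]; constructor <;> linarith [hz.2.2.1, hz'.2.2.1, hz.2.2.2, hz'.2.2.2])
    rw [sub_re, sub_eq_zero] at hre
    rw [sub_im, sub_eq_zero] at him
    exact Complex.ext hre him

end Summit.KontsevichZagierPeriods.MultivaluedCoV.EllipticArea

end
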